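import Summits.AtomisticToContinuum.HydrodynamicLimit.Theorems.RelayRaceLocalityLightConeInLawSketchLine
import Literature.Analysis.FluidPDE.BBGKYMarginals

/-!
# Vocabulary of the line `susceptibility-variance-continuity` for the crux `LightConeInLaw`
(stmt-AtomisticToContinuum-12500; rank 2 of route `RelayRaceLocality`, sub-problem `HydrodynamicLimit`)

Definitions-only support file (`--supports stmt-AtomisticToContinuum-12500`) of the line lead (a1) of the line
`susceptibility-variance-continuity` (registered skeleton
`Cruxes/LightConeInLaw/Lines/susceptibility_variance_continuity.lean`, stubs `stub_cone`, `stub_var`,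
`stub_countCLT`, `stub_susceptibility`, `stub_chain`; composition `LightConeInLaw_of` kernel-checked modulo the
stubs). It makes the line's vocabulary IMPORTABLE (the skeleton lives under `Cruxes/`, which Theorems files may not
import), so that each registered stub can land in its own sorry-free Theorems file with the registered signature
verbatim. The definitions are byte-identical to the planner's (crux-plan seat
planner-cruxplan-stmt-AtomisticToContinuum-12500-susceptibility-varia-0):

* `wZ w ν = Σₙ wₙ νⁿ`, `wP w ν n = wₙ νⁿ / wZ w ν`, `wMean w g ν = Σₙ wP w ν n · g n` — an exponential family of
  weights on `ℕ` and its means (all `tsum`s, junk `0` where not summable);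
* `canonicalWeights σ₁ f N n = Z_{N,n}/n!` (`Z_{N,n} = canonicalPartition G3 (hsDiameter σ₁ N) n f`), the
  Poissonised COUNT LAW `countWeight`, its `meanCount` and `varCount`;
* `canonicalMean` (expectation under the canonical local Gibbs law `particleLaw Ψ (canonicalDensity …)`),
  `mixtureMean`, `mixtureVariance` (Poissonised mixtures along a family of flows);
* `wZ_canonicalWeights`: the partition sum of the canonical weights IS `gcPartition` (term by term).

Nothing is asserted beyond that dictionary identity.
-/

namespace Summit.AtomisticToContinuum.HydrodynamicLimit.Theorems.LightConeInLawSVC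

open scoped BigOperators Topology Classical ENNReal
open Filter Set MeasureTheory
open Literature.MathematicalPhysics.KineticTheory Literature.Analysis.FluidPDE
open Summit.AtomisticToContinuum.HydrodynamicLimit.Theorems.LightConeInLawSketch

noncomputable section

/-! ## Exponential families of weights on `ℕ` -/

/-- Partition sum of an abstract weight sequence `w` at parameter `ν`: `Z_w(ν) = Σₙ wₙ νⁿ` (a `tsum`, junk `0` where
not summable). -/
def wZ (w : ℕ → ℝ) (ν : ℝ) : ℝ := ∑' n : ℕ, w n * ν ^ n

/-- The exponential family of probability weights `p_ν(n) = wₙ νⁿ / Z_w(ν)` generated by `w` (junk: `x / 0 = 0`). -/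
def wP (w : ℕ → ℝ) (ν : ℝ) (n : ℕ) : ℝ := w n * ν ^ n / wZ w ν

/-- The `p_ν`-mean of a sequence `g`: `⟨g⟩_ν = Σₙ p_ν(n) g(n)` (a `tsum`, junk `0` where not summable). -/
def wMean (w g : ℕ → ℝ) (ν : ℝ) : ℝ := ∑' n : ℕ, wP w ν n * g n

/-! ## The Poissonised canonical family of the hard-sphere gas -/

/-- The canonical weights of the hard-sphere gas of diameter `hsDiameter σ₁ N` with one-particle profile `f`:
`w_N(n) = Z_{N,n} / n!`, `Z_{N,n} = canonicalPartition` (so that `wZ (canonicalWeights σ₁ f N) μ = gcPartition … μ f`,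
the grand-canonical partition function, term by term: `wZ_canonicalWeights`). -/
def canonicalWeights (σ₁ : ℝ) (f : T3 × V3 → ℝ) (N : ℕ) (n : ℕ) : ℝ :=
  canonicalPartition G3 (hsDiameter σ₁ N) n f / (n.factorial : ℝ)

/-- The POISSONISED (grand-canonical) count law of the gas: `p_{N,μ}(n) = μⁿ Z_{N,n} / (n! Ξ_N(μ))`. -/
def countWeight (σ₁ : ℝ) (f : T3 × V3 → ℝ) (μ : ℝ) (N n : ℕ) : ℝ :=
  wP (canonicalWeights σ₁ f N) μ n

/-- Mean particle number of the Poissonised gas at activity `μ`. -/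
def meanCount (σ₁ : ℝ) (f : T3 × V3 → ℝ) (μ : ℝ) (N : ℕ) : ℝ :=
  wMean (canonicalWeights σ₁ f N) (fun n => (n : ℝ)) μ

/-- Variance of the particle number of the Poissonised gas at activity `μ` (second moment minus squared mean). -/
def varCount (σ₁ : ℝ) (f : T3 × V3 → ℝ) (μ : ℝ) (N : ℕ) : ℝ :=
  wMean (canonicalWeights σ₁ f N) (fun n => (n : ℝ) ^ 2) μ - meanCount σ₁ f μ N ^ 2

/-- Canonical expectation of an observable `O` of `n` spheres under the canonical local Gibbs law of profile `f`
and diameter `hsDiameter σ₁ N` (the law `particleLaw Ψ (canonicalDensity …)` of the crux's comparison gas; the flow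
`Ψ` only fixes the phase space). Junk `0` where not integrable / where `Z_{N,n} = 0` (zero measure). -/
def canonicalMean (σ₁ : ℝ) (f : T3 × V3 → ℝ) (N n : ℕ) (Ψ : HardSphereFlow G3 (hsDiameter σ₁ N) n)
    (O : Config n (Fin 3) T3 → ℝ) : ℝ :=
  ∫ z, O z ∂(particleLaw Ψ (canonicalDensity G3 (hsDiameter σ₁ N) n f))

/-- Mixture (Poissonised) mean of a family of observables `O n` along a family of flows `Ψ n` (one per particle
number) at activity `μ`: `Σₙ p_{N,μ}(n) E_{π_{N,n}}[O n]`. -/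
def mixtureMean (σ₁ : ℝ) (f : T3 × V3 → ℝ) (μ : ℝ) (N : ℕ)
    (Ψ : (n : ℕ) → HardSphereFlow G3 (hsDiameter σ₁ N) n) (O : (n : ℕ) → Config n (Fin 3) T3 → ℝ) : ℝ :=
  wMean (canonicalWeights σ₁ f N) (fun n => canonicalMean σ₁ f N n (Ψ n) (O n)) μ

/-- Mixture (Poissonised) variance of a family of observables: second mixture moment minus squared mixture mean. -/
def mixtureVariance (σ₁ : ℝ) (f : T3 × V3 → ℝ) (μ : ℝ) (N : ℕ)
    (Ψ : (n : ℕ) → HardSphereFlow G3 (hsDiameter σ₁ N) n) (O : (n : ℕ) → Config n (Fin 3) T3 → ℝ) : ℝ :=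
  mixtureMean σ₁ f μ N Ψ (fun n z => O n z ^ 2) - mixtureMean σ₁ f μ N Ψ O ^ 2

/-- Dictionary check: the partition sum of the canonical weights IS the tree's grand-canonical partition function
`gcPartition` (term by term), so `countWeight σ₁ f μ N n = μⁿ Z_{N,n} / (n! · gcPartition … μ f)`. [folklore] -/
theorem wZ_canonicalWeights :
    ∀ (σ₁ : ℝ) (f : T3 × V3 → ℝ) (N : ℕ) (μ : ℝ),
      wZ (canonicalWeights σ₁ f N) μ = gcPartition G3 (hsDiameter σ₁ N) μ f := by
  intro σ₁ f N μ
  unfold wZ canonicalWeights gcPartition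
  exact tsum_congr fun n => by ring

/-- Unfolding lemma: the count law is the exponential family of the canonical weights. [folklore] -/
theorem countWeight_eq (σ₁ : ℝ) (f : T3 × V3 → ℝ) (μ : ℝ) (N n : ℕ) :
    countWeight σ₁ f μ N n =
      canonicalWeights σ₁ f N n * μ ^ n / wZ (canonicalWeights σ₁ f N) μ := rfl

/-- Unfolding lemma: the mixture variance is the `wMean`-variance of the canonical means. [folklore] -/
theorem mixtureVariance_eq (σ₁ : ℝ) (f : T3 × V3 → ℝ) (μ : ℝ) (N : ℕ)
    (Ψ : (n : ℕ) → HardSphereFlow G3 (hsDiameter σ₁ N) n) (O : (n : ℕ) → Config n (Fin 3) T3 → ℝ) :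
    mixtureVariance σ₁ f μ N Ψ O =
      wMean (canonicalWeights σ₁ f N) (fun n => canonicalMean σ₁ f N n (Ψ n) (fun z => O n z ^ 2)) μ -
        wMean (canonicalWeights σ₁ f N) (fun n => canonicalMean σ₁ f N n (Ψ n) (O n)) μ ^ 2 := rfl

end

end Summit.AtomisticToContinuum.HydrodynamicLimit.Theorems.LightConeInLawSVC
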